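import Literature.Probability.Percolation.QuadCrossingGeneralPosition
import Literature.Probability.Percolation.QuadCrossingDiscreteGluingGarban
import Literature.Probability.Percolation.GluingFinalEstimates
import Literature.Probability.Percolation.QuadCrossingNoiseDiscrete
import HarnessLib

/-!
# The assembly of Schramm–Smirnov's Prop. 4.1 from the coarse-grained surrogate

Topic `Probability/Percolation`.  Support file (definitions and proofs, no named fact) for the
named fact `SchrammSmirnov2011_thm_1_7` (`QuadCrossingNoise.lean`): the FINAL ESTIMATES of the
proof of Prop. 4.1 (Ann. Probab. 39 (2011), §4, p. 20, "Final estimates") and the return to the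
quad-crossing space.  Given, at every small mesh, the output of the bays-and-beaches construction
— a stopping set `N` whose unexplored edges lie in the `s`-neighbourhood of the cut `α`, a modified
event `E'` close to the crossing event `E = {ω_δ ∈ ⊞_{Q₀}}`, and a surrogate `Z`, a function of
the crossing bits of a FIXED finite family `F` of quads of `D ∖ α`, close in `L²` to the
conditional probability `Ỹ = P(E' | ω|_N)` (`GluingSurrogate`, the content of steps (A) and (C) of
the printed proof, cf. `PortChain`, `PortLink`, `PortCount`, `ZonesOwners` for (C)) — the discrete
gluing theorem (Thm. 1.1 for bond-`ℤ²`, `discreteGluing_sq_of_finite_inter`) and the Hilbert-space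
manipulation `gluing_final_estimates` give an event `𝒲` measurable for the crossing events of `F`
with `μ_δ(𝒲 Δ ⊞_{Q₀}) ≤ ε` at every small mesh (`gluingConclusion_of_surrogate`); with the
reduction `SchrammSmirnov2011_thm_1_7_of_frequently_gluing_finite_inter` this proves Theorem 1.7
from the surrogate hypothesis (`SchrammSmirnov2011_thm_1_7_of_surrogate`).

## References

* O. Schramm, S. Smirnov, *On the scaling limits of planar percolation*, Ann. Probab. 39 (2011)
  1768–1814, arXiv:1101.5820, §4, proof of Prop. 4.1 ("Final estimates") and proof of Thm. 1.7.
  [SchrammSmirnov2011]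
-/

noncomputable section

open Set Metric MeasureTheory Filter Topology
open scoped symmDiff ENNReal
open Literature.Probability.LatticeModels

namespace Literature.Probability.Percolation

namespace QuadCrossing

variable {D : Set ℂ}

/-- **The edges near the cut**: lattice edges whose drawn segment at mesh `δ` meets the
`s`-neighbourhood of `α` (the block `B` of Thm. 1.1). [cite: SchrammSmirnov2011, Thm. 1.1 (𝓕_s)] -/
def cutEdges (α : Set ℂ) (s δ : ℝ) : Set (Sym2 (Site 2)) :=
  {e | ∃ x y : Site 2, (zdGraph 2).Adj x y ∧ (segment ℝ (meshPoint δ x) (meshPoint δ y) ∩ thickening s α).Nonempty ∧ e = s(x, y)}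

/-- The edges near a bounded cut form a finite set. [folklore] -/
theorem cutEdges_finite {α : Set ℂ} (hα : Bornology.IsBounded α) (s : ℝ) {δ : ℝ} (hδ : 0 < δ) :
    (cutEdges α s δ).Finite :=
  finite_setOf_edge_meeting (hα.thickening) hδ

/-- **The surrogate at mesh `δ`** (the output of the bays-and-beaches construction, SS11 §4 steps
(A) and (C)): a window `G₀` and a stopping set `N ⊆ G₀` whose unexplored edges `G₀ ∖ N(ω)` lie near
the cut, a measurable event `E'` with `P(E Δ E') ≤ ε₀` (`E = {ω_δ ∈ ⊞_{Q₀}}`), and a measurable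
`Z`, `|Z| ≤ 1`, with `‖Z - P(E' | ω|_N)‖₂² ≤ ε₀`, which is a function of the crossing bits at mesh
`δ` of the quads of `F`. [cite: SchrammSmirnov2011, §4, proof of Prop. 4.1 ((4.4)–(4.6), Ỹ_T)] -/
def GluingSurrogateAt (D α : Set ℂ) (Q₀ : Quad D) (F : Set (Quad D)) (s ε₀ δ : ℝ) : Prop :=
  ∃ (G₀ : Finset (Sym2 (Site 2))) (N : BondConfig (Site 2) → Finset (Sym2 (Site 2)))
    (E' : Set (BondConfig (Site 2))) (Z : BondConfig (Site 2) → ℝ),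
    IsStoppingSet N ∧ (∀ ω, N ω ⊆ G₀) ∧ (∀ ω, ∀ e ∈ G₀ \ N ω, e ∈ cutEdges α s δ) ∧
    MeasurableSet E' ∧
    (bondPercolation (zdGraph 2) half).real ((z2QuadConfig D δ ⁻¹' QuadConfig.crossedEvent Q₀) ∆ E') ≤ ε₀ ∧
    Measurable Z ∧ (∀ ω, |Z ω| ≤ 1) ∧
    ∫ ω, (Z ω - stoppedCondProb (zdGraph 2) half G₀ N E' ω) ^ 2 ∂(bondPercolation (zdGraph 2) half) ≤ ε₀ ∧
    ∃ φ : Set (Quad D) → ℝ, ∀ ω, Z ω = φ {Q | Q ∈ F ∧ z2QuadConfig D δ ω ∈ QuadConfig.crossedEvent Q}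

/-- **The surrogate hypothesis** for the data `(D, μ, α, Q₀)`: for every accuracy `ε₀` and every
small neighbourhood width `s` there is a finite family `F` of `μ`-continuity quads of `D ∖ α` such
that the surrogate exists at every small mesh.  This is the statement of steps (A) (coarse-graining
by the tessellation `T`, `𝓕_T`-measurability of `(Z_o, Z_c, G)`) and (C) (connectivity in the
coarse-grained model, (4.6)) of the printed proof. [cite: SchrammSmirnov2011, §4, proof of Prop. 4.1] -/
def GluingSurrogate (D : Set ℂ) (μ : Measure (QuadConfig D)) (α : Set ℂ) (Q₀ : Quad D) : Prop :=
  ∀ ε₀ : ℝ, 0 < ε₀ → ∃ s₁ : ℝ, 0 < s₁ ∧ ∀ s : ℝ, 0 < s → s < s₁ →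
    ∃ F : Set (Quad D), F.Finite ∧ (∀ Q ∈ F, Q.carrier ⊆ D \ α ∧ μ (frontier (QuadConfig.crossedEvent Q)) = 0) ∧
      ∃ δ₀ : ℝ, 0 < δ₀ ∧ ∀ δ : ℝ, 0 < δ → δ < δ₀ → GluingSurrogateAt D α Q₀ F s ε₀ δ

/-! ### Events described by finitely many crossing bits -/

/-- **An event read off the crossing bits of `F`** is measurable for the `σ`-field generated by the
crossing events of `F` (a finite union of atoms). [folklore] -/
theorem measurableSet_generateFrom_of_bits {F : Set (Quad D)} (hF : F.Finite) (P : Set (Quad D) → Prop) :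
    MeasurableSet[MeasurableSpace.generateFrom ((fun Q => QuadConfig.crossedEvent Q) '' F)]
      {q : QuadConfig D | P {Q | Q ∈ F ∧ q ∈ QuadConfig.crossedEvent Q}} := by
  classical
  set m := MeasurableSpace.generateFrom ((fun Q => QuadConfig.crossedEvent Q) '' F) with hm
  -- the atoms
  have hgen : ∀ Q ∈ F, MeasurableSet[m] (QuadConfig.crossedEvent Q) :=
    fun Q hQ => MeasurableSpace.measurableSet_generateFrom ⟨Q, hQ, rfl⟩
  have hatom : ∀ S : Set (Quad D), MeasurableSet[m] {q : QuadConfig D | {Q | Q ∈ F ∧ q ∈ QuadConfig.crossedEvent Q} = S} := by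
    intro S
    by_cases hS : S ⊆ F
    · have : {q : QuadConfig D | {Q | Q ∈ F ∧ q ∈ QuadConfig.crossedEvent Q} = S} =
          (⋂ Q ∈ hF.toFinset.filter (· ∈ S), QuadConfig.crossedEvent Q) ∩
            ⋂ Q ∈ hF.toFinset.filter (· ∉ S), (QuadConfig.crossedEvent Q)ᶜ := by
        ext q
        simp only [mem_setOf_eq, mem_inter_iff, mem_iInter, Finset.mem_filter, Set.Finite.mem_toFinset, mem_compl_iff]
        constructor
        · intro h
          refine ⟨fun Q ⟨hQF, hQS⟩ => ?_, fun Q ⟨hQF, hQS⟩ hq => hQS ?_⟩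
          · have : Q ∈ {Q | Q ∈ F ∧ q ∈ QuadConfig.crossedEvent Q} := h.symm ▸ hQS
            exact this.2
          · rw [← h]; exact ⟨hQF, hq⟩
        · rintro ⟨h1, h2⟩
          ext Q
          simp only [mem_setOf_eq]
          constructor
          · rintro ⟨hQF, hq⟩
            by_contra hQS
            exact h2 Q ⟨hQF, hQS⟩ hq
          · intro hQS
            exact ⟨hS hQS, h1 Q ⟨hS hQS, hQS⟩⟩
      rw [this]
      refine MeasurableSet.inter (Finset.measurableSet_biInter _ fun Q hQ => ?_) (Finset.measurableSet_biInter _ fun Q hQ => ?_)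
      · exact hgen Q ((Set.Finite.mem_toFinset _).1 (Finset.mem_filter.1 hQ).1)
      · exact (hgen Q ((Set.Finite.mem_toFinset _).1 (Finset.mem_filter.1 hQ).1)).compl
    · have : {q : QuadConfig D | {Q | Q ∈ F ∧ q ∈ QuadConfig.crossedEvent Q} = S} = ∅ := by
        ext q
        simp only [mem_setOf_eq, mem_empty_iff_false, iff_false]
        intro h
        exact hS (h ▸ fun Q hQ => hQ.1)
      rw [this]; exact MeasurableSet.empty
  -- the event is the union of the atoms of the subsets satisfying `P`
  have : {q : QuadConfig D | P {Q | Q ∈ F ∧ q ∈ QuadConfig.crossedEvent Q}} =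
      ⋃ S ∈ (hF.toFinset.powerset.filter fun S : Finset (Quad D) => P (↑S : Set (Quad D))),
        {q : QuadConfig D | {Q | Q ∈ F ∧ q ∈ QuadConfig.crossedEvent Q} = (↑S : Set (Quad D))} := by
    ext q
    simp only [mem_setOf_eq, mem_iUnion, Finset.mem_filter, Finset.mem_powerset, exists_prop]
    constructor
    · intro h
      have hfin : {Q | Q ∈ F ∧ q ∈ QuadConfig.crossedEvent Q}.Finite := hF.subset fun Q hQ => hQ.1
      refine ⟨hfin.toFinset, ⟨fun Q hQ => ?_, by simpa using h⟩, by simp⟩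
      rw [Set.Finite.mem_toFinset] at hQ ⊢
      exact hQ.1
    · rintro ⟨S, ⟨-, hP⟩, hS⟩
      rwa [hS]
  rw [this]
  exact Finset.measurableSet_biUnion _ fun S _ => hatom _

/-! ### The conclusion of Prop. 4.1 from the surrogate -/

/-- **The final estimates** (SS11 §4, p. 20): at a mesh where the surrogate exists and Thm. 1.1
applies, the event `{Z > 1/2}`, read off the crossing bits of `F`, satisfies
`μ_δ(𝒲 Δ ⊞_{Q₀}) ≤ 78 ε₀`. [cite: SchrammSmirnov2011, §4, proof of Prop. 4.1 ("Final estimates")] -/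
theorem measure_symmDiff_le_of_surrogateAt (hD : IsOpen D) {α : Set ℂ} (hα : Bornology.IsBounded α) (Q₀ : Quad D)
    {F : Set (Quad D)} (hF : F.Finite) {s ε₀ δ : ℝ} (hδ : 0 < δ)
    (h42 : ∀ B : Finset (Sym2 (Site 2)), ↑B = cutEdges α s δ →
      ∫ ω, ((z2QuadConfig D δ ⁻¹' QuadConfig.crossedEvent Q₀).indicator (1 : BondConfig (Site 2) → ℝ) ω -
          blockCondProb (zdGraph 2) half B (z2QuadConfig D δ ⁻¹' QuadConfig.crossedEvent Q₀) ω) ^ 2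
        ∂(bondPercolation (zdGraph 2) half) ≤ 5 / 4 * ε₀)
    (hsur : GluingSurrogateAt D α Q₀ F s ε₀ δ) :
    ∃ W : Set (QuadConfig D),
      MeasurableSet[MeasurableSpace.generateFrom ((fun Q => QuadConfig.crossedEvent Q) '' F)] W ∧
      (z2QuadLaw D δ : Measure (QuadConfig D)) (W ∆ QuadConfig.crossedEvent Q₀) ≤ ENNReal.ofReal (78 * ε₀) := by
  obtain ⟨G₀, N, E', Z, hN, hNG, hcut, hE', h44, hZm, hZ1, h46, φ, hφ⟩ := hsur
  set P := bondPercolation (zdGraph 2) half with hP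
  set E := z2QuadConfig D δ ⁻¹' QuadConfig.crossedEvent Q₀ with hE
  have hEm : MeasurableSet E := measurableSet_preimage_crossedEvent hδ Q₀
  -- the block of Thm. 1.1
  set B : Finset (Sym2 (Site 2)) := (cutEdges_finite hα s hδ).toFinset with hB
  have hBeq : (↑B : Set (Sym2 (Site 2))) = cutEdges α s δ := by rw [hB, Set.Finite.coe_toFinset]
  have hBsub : ∀ ω, G₀ \ N ω ⊆ B := fun ω e he => by
    rw [hB, Set.Finite.mem_toFinset]; exact hcut ω e he
  -- the final estimates
  have hfinal := gluing_final_estimates (zdGraph 2) half hN hNG hBsub hEm hE' h44 (h42 B hBeq) hZm hZ1 h46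
  -- the event read off the bits
  refine ⟨{q | 1 / 2 < φ {Q | Q ∈ F ∧ q ∈ QuadConfig.crossedEvent Q}}, measurableSet_generateFrom_of_bits hF (fun S => 1 / 2 < φ S), ?_⟩
  have hWm : MeasurableSet {q : QuadConfig D | 1 / 2 < φ {Q | Q ∈ F ∧ q ∈ QuadConfig.crossedEvent Q}} := by
    refine MeasurableSpace.generateFrom_le ?_ _ (measurableSet_generateFrom_of_bits hF fun S => 1 / 2 < φ S)
    rintro _ ⟨Q, -, rfl⟩
    exact QuadConfig.measurableSet_crossedEvent Q
  rw [z2QuadLaw_apply hD hδ (hWm.symmDiff (QuadConfig.measurableSet_crossedEvent Q₀))]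
  have hpre : z2QuadConfig D δ ⁻¹' ({q | 1 / 2 < φ {Q | Q ∈ F ∧ q ∈ QuadConfig.crossedEvent Q}} ∆ QuadConfig.crossedEvent Q₀) =
      {ω | 1 / 2 < Z ω} ∆ E := by
    ext ω
    simp only [Set.preimage_symmDiff, Set.mem_symmDiff, mem_preimage, mem_setOf_eq, hφ ω, hE]
  rw [hpre, ← hP]
  have hreal : P.real ({ω | 1 / 2 < Z ω} ∆ E) ≤ 78 * ε₀ := by
    refine hfinal.trans ?_; nlinarith
  rw [← ENNReal.ofReal_toReal (measure_ne_top P _)]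
  exact ENNReal.ofReal_le_ofReal hreal

/-- **The conclusion of Prop. 4.1 from the surrogate hypothesis.**  For `D` open, `μ` any measure
(the subsequential limit enters only through the null-frontier requirement on `F`), meshes
`δₖ → 0⁺`, a cut `α` (a finite union of finite-length paths) meeting `∂[Q₀]` finitely often and
`ε > 0`: there is a finite family `F` of `μ`-continuity quads of `D ∖ α` such that, frequently in
`k`, some event measurable for the crossing events of `F` is `ε`-close to `⊞_{Q₀}` under
`squareCrossingLaw D (δs k)`. [cite: SchrammSmirnov2011, Prop. 4.1 and §4 ("Final estimates")] -/
theorem gluingConclusion_of_surrogate (hD : IsOpen D) (μ : Measure (QuadConfig D)) {δs : ℕ → ℝ}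
    (hpos : ∀ k, 0 < δs k) (h0 : Tendsto δs atTop (𝓝 0)) {α : Set ℂ} (hα : IsFiniteLengthPathUnion α)
    (Q₀ : Quad D) (hfin : (α ∩ frontier Q₀.carrier).Finite) (hsur : GluingSurrogate D μ α Q₀)
    {ε : ℝ} (hε : 0 < ε) :
    ∃ F : Set (Quad D), F.Finite ∧
      (∀ Q ∈ F, Q.carrier ⊆ D \ α ∧ μ (frontier (QuadConfig.crossedEvent Q)) = 0) ∧
      ∃ᶠ k in atTop, ∃ W : Set (QuadConfig D),
        MeasurableSet[MeasurableSpace.generateFrom ((fun Q => QuadConfig.crossedEvent Q) '' F)] W ∧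
        (squareCrossingLaw D (δs k) : Measure (QuadConfig D)) (W ∆ QuadConfig.crossedEvent Q₀) ≤ ENNReal.ofReal ε := by
  -- accuracy
  set ε₀ : ℝ := min (ε / 78) (1 / 2) with hε₀
  have hε₀pos : 0 < ε₀ := lt_min (by positivity) (by norm_num)
  have hε₀1 : ε₀ < 1 := (min_le_right _ _).trans_lt (by norm_num)
  have hε₀ε : 78 * ε₀ ≤ ε := by
    have := min_le_left (ε / 78) (1 / 2); rw [← hε₀] at this; linarith
  -- Thm. 1.1 and the surrogate at a common small `s`
  obtain ⟨s₀, hs₀, h11⟩ := discreteGluing_sq_of_finite_inter Q₀ hα hfin hε₀pos hε₀1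
  obtain ⟨s₁, hs₁, hS⟩ := hsur ε₀ hε₀pos
  set s : ℝ := min s₀ s₁ / 2 with hs
  have hs_pos : 0 < s := by rw [hs]; positivity
  have hs_lt₀ : s < s₀ := by
    rw [hs]; have := min_le_left s₀ s₁; linarith
  have hs_lt₁ : s < s₁ := by
    rw [hs]; have := min_le_right s₀ s₁; linarith
  obtain ⟨δ₁, hδ₁, h11δ⟩ := h11 s hs_pos hs_lt₀
  obtain ⟨F, hF, hFq, δ₂, hδ₂, hSδ⟩ := hS s hs_pos hs_lt₁
  refine ⟨F, hF, hFq, ?_⟩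
  -- every small mesh works; the mesh of `squareCrossingLaw D δ` in lattice units is `δ √2`
  have h2 : (0 : ℝ) < Real.sqrt 2 := Real.sqrt_pos.mpr (by norm_num)
  have hev : ∀ᶠ k in atTop, δs k * Real.sqrt 2 < min δ₁ δ₂ := by
    have ht : Tendsto (fun k => δs k * Real.sqrt 2) atTop (𝓝 0) := by simpa using h0.mul_const (Real.sqrt 2)
    exact ht.eventually (gt_mem_nhds (lt_min hδ₁ hδ₂))
  refine hev.frequently.mono fun k hk => ?_
  set δ := δs k * Real.sqrt 2 with hδ
  have hδpos : 0 < δ := mul_pos (hpos k) h2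
  obtain ⟨W, hWm, hW⟩ := measure_symmDiff_le_of_surrogateAt hD hα.isCompact.isBounded Q₀ hF hδpos
    (fun B hB => h11δ δ hδpos (hk.trans_le (min_le_left _ _)) B hB)
    (hSδ δ hδpos (hk.trans_le (min_le_right _ _)))
  refine ⟨W, hWm, ?_⟩
  rw [squareCrossingLaw_eq_z2QuadLaw]
  exact hW.trans (ENNReal.ofReal_le_ofReal hε₀ε)

/-- **Theorem 1.7 from the surrogate hypothesis** at every subsequential limit and every quad in
general position (null frontier, finitely many junctions): the remaining content of the printed
proof is exactly `GluingSurrogate` (steps (A) and (C) of the proof of Prop. 4.1).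
[cite: SchrammSmirnov2011, Thm. 1.7 (proof) and Prop. 4.1] -/
theorem SchrammSmirnov2011_thm_1_7_of_surrogate
    (hsur : ∀ (D : Set ℂ), IsOpen D → IsConnected D →
      ∀ (μ : FiniteMeasure (QuadConfig D)), IsSubseqQuadLimit D μ →
      ∀ α : Set ℂ, IsFiniteLengthPathUnion α →
      ∀ Q₀ : Quad D, (μ : Measure (QuadConfig D)) (frontier (QuadConfig.crossedEvent Q₀)) = 0 →
        (α ∩ frontier Q₀.carrier).Finite → GluingSurrogate D μ α Q₀) :
    SchrammSmirnov2011_thm_1_7 := by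
  refine SchrammSmirnov2011_thm_1_7_of_frequently_gluing_finite_inter ?_
  intro D hD hD' μ δs hpos h0 hlim α hα Q₀ hQ₀ hfin ε hε
  exact gluingConclusion_of_surrogate hD μ hpos h0 hα Q₀ hfin
    (hsur D hD hD' μ ⟨δs, hpos, h0, hlim⟩ α hα Q₀ hQ₀ hfin) hε

end QuadCrossing

end Literature.Probability.Percolation

end
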